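import Summits.BirchSwinnertonDyer.Rank1Residual.X9.PrintCertBridge
import Literature.NumberTheory.EllipticCurves.Rank1Residual.X9TrivialPartner
import HarnessLib

/-!
# Leaves X9 / X10b — per-pair certificate records: the record's OWN curve (Kraus minimality) and what a
# record CLAIMS about it (companion of `X9/PrintCertSchema.lean` and `X9/PrintCertBridge.lean`)

HONEST FRAMING (cell `bsd-print-x9`, D-0131 (2) print tier; partition leaves `ClassX9` and
`ClassX10 ∧ ¬Surj`): four decidable plumbing definitions (Kraus' minimality certificate), CLAIM definitions
(`Prop`s taken as hypotheses, D-0014 style — what the engines computed, NOT rechecked by the kernel) and their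
elementary consumers; no named fact; nothing asserted about any curve; no leaf is claimed closed.
* `Record.krausCheck` / `isGloballyMinimal_curve_of_krausCheck`: the record's model `r.curve` is GLOBALLY
  MINIMAL in the kernel (Kraus 1989 via the tree's `X11b.isGloballyMinimal_of_krausCriterion₂`; decidable per
  record; the few models outside Kraus' `2`-adic clauses keep minimality as the instance hypothesis).
For a record `r`, any `W/ℚ` (intended: `integralModelInt W = r.intCurve`) and a prime `q` (= `r.p`; free so
that literal `3`/`5`/`7` fit):
* `ClaimRank` (`r_an(W) = r.rank`), `ClaimBSDData` (`#E(ℚ)_tors`, `∏c_q`, Miller's `#Ш_an(W) = r.shaAn`),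
  and in `ClaimAt`: `¬Surj W q` (Cremona/Sutherland `galrep`; in print it follows from the record's image
  certificate `j(E) = J_G(t)` by Zywina 2015 Thm. 1.2/1.4/1.5 (ii) = Sutherland–Zywina 2017 §1);
* the two-engine IWASAWA CERTIFICATE `ClaimLambdaAt`: for every newform `f` of `W` and `ϖ` with
  `ϖ·Ω_E = Ω⁺_f`, the coefficient of index `r.lambdaAn` of the Néron-normalised cyclotomic `p`-adic
  `L`-function `ϖ·L_p(f, α, T)` is a `p`-adic UNIT and all lower coefficients are non-units (`μ_an = 0`,
  `λ_an = r.lambdaAn`; Greenberg–Vatsal (1)–(2)). Consumers: `exists_unit_coeff_neron` (the `hcert` shape of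
  `X9.mazurMainConjecture_of_ainvs_of_bsdp` / `X9MuInvariant` / the `MuZeroRoad` records) and, through the
  period unit (`realPeriodRat_eq_unit_mul_plusPeriod{,_three}`, `norm_periodRatio_eq_one_of_odd`),
  `exists_unit_coeff` and `norm_coeff_eq_one` (the per-pair instance of `AnalyticMuZeroOnClassX9` /
  `AnalyticMuZeroOnClassX10b`, the `hA` binder of the K6 leaf bridges; the ONE-COEFFICIENT data
  `‖L_p(f,α)(0)‖ = 1` (`λ_an = 0`) / `‖[T¹]L_p(f,α)‖ = 1` (`λ_an = 1`) of `PrintX9KatoLambdaMatch`).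
* Display-list corollaries: `classX9_of_certified` / `classX9_of_certified_of_claims` /
  `classX10b_of_certified_of_claims` (leaf membership of every listed record's curve, kernel-checked up to the
  two claims `¬Surj`, `r_an = rank`).
References: [Kraus1989] Prop. 1–2; [GreenbergVatsal2000] (1)–(2), §3 Rem. 3.4; [GreenbergLNM1716] Conj. 1.11;
[Zywina2015] Thm. 1.4; [Miller2011LMS] Def. 1.1; [Cremona2006].
-/

set_option autoImplicit false

noncomputable section

open scoped Classical MatrixGroups ModularForm

open CongruenceSubgroup WeierstrassCurve Literature.NumberTheory.EllipticCurves
  Literature.NumberTheory.EllipticCurves.ModularForms Literature.NumberTheory.EllipticCurves.Rank1Residual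
  Literature.NumberTheory.EllipticCurves.Rank1Residual.X11RankOneCertificates
  Summit.BirchSwinnertonDyer.BirchSwinnertonDyer.Rank1Residual.IntModel Summit.BirchSwinnertonDyer.Rank1Residual.X11b

namespace Summit.BirchSwinnertonDyer.Rank1Residual.X9.PrintCert

namespace Record

variable (r : Record)

/-! ### Global minimality of the record's model by Kraus' criterion (decidable, per record) -/

/-- Kraus' sufficient condition for minimality at `q` on the data `(c₄, c₆, Δ)` of `ainvs`, as the tree's
`X11b.isGloballyMinimal_of_krausCriterion₂` consumes it: `q¹² ∤ Δ ∨ q⁴ ∤ c₄`, or the patterns at `2`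
(`2⁸ ∤ c₄ ∧ 2⁷ ∣ c₆`; `2²⁴ ∤ Δ ∧ 1024 ‖ c₆` oddly) and at `3` (`3⁸ ‖ c₆`). [cite: Kraus1989, Prop. 1 and Prop. 2] -/
def krausClause (q : ℕ) : Bool :=
  decide (¬ (q : ℤ) ^ 12 ∣ discOf r.ainvs) || decide (¬ (q : ℤ) ^ 4 ∣ c4Of r.ainvs) ||
  decide (q = 2 ∧ ¬ (2 : ℤ) ^ 8 ∣ c4Of r.ainvs ∧ (2 : ℤ) ^ 7 ∣ c6Of r.ainvs) ||
  decide (q = 2 ∧ ¬ (2 : ℤ) ^ 24 ∣ discOf r.ainvs ∧ (1024 : ℤ) ∣ c6Of r.ainvs ∧ ¬ (2 : ℤ) ∣ c6Of r.ainvs / 1024) ||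
  decide (q = 3 ∧ (3 : ℤ) ^ 8 ∣ c6Of r.ainvs ∧ ¬ (3 : ℤ) ^ 9 ∣ c6Of r.ainvs)

/-- The least `B ≥ 1` with `|Δ| < B¹²`, searched with fuel (junk = the fuel's end). [folklore] -/
def krausBoundAux : ℕ → ℕ → ℕ
  | 0, B => B
  | fuel + 1, B => if (discOf r.ainvs).natAbs < B ^ 12 then B else krausBoundAux fuel (B + 1)

/-- The bound below which Kraus' clauses are checked (`|Δ| < krausBound¹²`, rechecked). [folklore] -/
def krausBound : ℕ := r.krausBoundAux 4096 1

/-- Kraus' minimality certificate of the record's model: `Δ ≠ 0`, `|Δ| < B¹²` for `B = krausBound`, and for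
every `q < B`: `q < 2`, or Kraus' clause at `q`, or `q` is visibly composite. [cite: Kraus1989, Prop. 1 and Prop. 2] -/
def krausCheck : Bool :=
  decide (discOf r.ainvs ≠ 0) && decide ((discOf r.ainvs).natAbs < r.krausBound ^ 12) &&
  (List.range r.krausBound).all (fun q => decide (q < 2) || r.krausClause q ||
    (List.range q).any (fun d => decide (2 ≤ d ∧ q % d = 0)))

variable {r} in
/-- **The record's model is globally minimal** when `krausCheck` passes (Kraus 1989 via the tree's
`X11b.isGloballyMinimal_of_krausCriterion₂`; primes `q ≥ krausBound` have `q¹² > |Δ|`).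
[cite: Kraus1989, Prop. 1 and Prop. 2] [cite: SilvermanAEC2009, VII.1 Remark 1.1] -/
theorem isGloballyMinimal_curve_of_krausCheck (hc : r.check = true) (hk : r.krausCheck = true) :
    r.curve.IsGloballyMinimal := by
  obtain ⟨a1, a2, a3, a4, a6, hA, -⟩ := r.ainvs_spec_of_check hc
  rw [curve_eq hA]
  simp only [krausCheck, Bool.and_eq_true, decide_eq_true_eq, List.all_eq_true, List.mem_range,
    Bool.or_eq_true, List.any_eq_true] at hk
  obtain ⟨⟨hD0, hDB⟩, hall⟩ := hk
  rw [hA] at hD0 hDB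
  refine isGloballyMinimal_of_krausCriterion₂ a1 a2 a3 a4 a6 fun q hq ↦ ?_
  by_cases hqB : q < r.krausBound
  · rcases hall q hqB with (hlt | hcl) | ⟨d, hd, hd'⟩
    · exact absurd hq.two_le (by omega)
    · simp only [krausClause, Bool.or_eq_true, decide_eq_true_eq, hA] at hcl
      rcases hcl with (((h1 | h2) | h3) | ⟨h2q, h24, h1024, hodd⟩) | h5
      · exact Or.inl (Or.inl h1)
      · exact Or.inl (Or.inr h2)
      · exact Or.inr (Or.inl h3)
      · refine Or.inr (Or.inr (Or.inl ⟨h2q, h24, c6Of [a1, a2, a3, a4, a6] / 1024, ?_, hodd⟩))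
        exact (Int.mul_ediv_cancel' h1024).symm
      · exact Or.inr (Or.inr (Or.inr h5))
    · exact absurd ((Nat.dvd_prime hq).mp (Nat.dvd_of_mod_eq_zero hd'.2)) (by omega)
  · refine Or.inl (Or.inl fun hdvd ↦ ?_)
    have hle : ((q : ℤ) ^ 12).natAbs ≤ (discOf [a1, a2, a3, a4, a6]).natAbs := Int.natAbs_le_of_dvd_ne_zero hdvd hD0
    rw [Int.natAbs_pow, Int.natAbs_natCast] at hle
    have hB : r.krausBound ^ 12 ≤ q ^ 12 := Nat.pow_le_pow_left (by omega) 12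
    omega

/-- The record's curve is elliptic and, when `krausCheck` passes, globally minimal — as instances for the
display-list corollaries. [folklore] -/
theorem instances_of_check_of_krausCheck (hc : r.check = true) (hk : r.krausCheck = true) :
    r.curve.IsElliptic ∧ r.curve.IsGloballyMinimal :=
  ⟨(r.instances_of_check hc).2, r.isGloballyMinimal_curve_of_krausCheck hc hk⟩

/-! ### CLAIMS: what the record says about its curve beyond the recheck (hypotheses, D-0014 style) -/

section Claims

variable (W : WeierstrassCurve ℚ) [W.IsElliptic] [W.IsGloballyMinimal]

/-- CLAIM `r_an = rank`: the analytic rank of `W` is the record's `rank` (Cremona: rank `0`/`1`, root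
number, `L(E,1) ≠ 0` resp. `L'(E,1) ≠ 0`). Nothing asserted. [cite: Cremona2006, Table 1 (column r)] -/
def ClaimRank : Prop := W.analyticRank = r.rank

/-- CLAIM BSD data: `#E(ℚ)_tors`, `∏ c_q` and Miller's analytic order of `Ш` are the record's
(`shaAn W = r.shaAn`; for rank `0` this says `L(E,1)/Ω_E = x0 = shaAn·∏c/#tors²`, rechecked).
Nothing asserted. [cite: Miller2011LMS, §1 and Def. 1.1 (arXiv:1010.2431 p. 3)] -/
def ClaimBSDData : Prop :=
  W.torsionOrder = r.torsion ∧ W.tamagawaProduct = r.tamagawa ∧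
    Literature.NumberTheory.EllipticCurves.shaAn W = ((r.shaAn : ℕ) : ℂ)

/-- CLAIM — the TWO-ENGINE IWASAWA CERTIFICATE at the prime `q` (= `r.p`) (`μ_an = 0`, `λ_an = r.lambdaAn`):
for every newform `f` of `W` and every `ϖ ∈ ℚ` with `ϖ·Ω_E = Ω⁺_f`, the coefficient of index
`λ = r.lambdaAn` of `ϖ·L_q(f, α, T)` (`α` the unit root, `T` the tree's cyclotomic variable) is a `q`-adic
unit and every lower coefficient is a non-unit — Greenberg–Vatsal's `μ(𝓛) = 0`, `λ(𝓛) = λ`. A finite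
exact modular-symbol computation per pair (engines in `r.engines`); nothing asserted.
[cite: GreenbergVatsal2000, p. 2–3, (1)–(2) (shape only; nothing asserted)] -/
def ClaimLambdaAt (q : ℕ) [Fact q.Prime] : Prop :=
  ∀ {N : ℕ} [NeZero N] (f : CuspForm (Gamma0 N) 2), IsNewformOf W f →
    ∀ (ϖ : ℚ), (ϖ : ℝ) * W.realPeriodRat = plusPeriod f →
      ‖PowerSeries.coeff r.lambdaAn
          (PowerSeries.C (ϖ : ℚ_[q]) * padicLFunction f (unitRoot W q : ℚ_[q]))‖ = 1 ∧
        ∀ m < r.lambdaAn, ‖PowerSeries.coeff m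
          (PowerSeries.C (ϖ : ℚ_[q]) * padicLFunction f (unitRoot W q : ℚ_[q]))‖ < 1

/-- The record's CLAIM about `W` at the prime `q` (= `r.p`): `¬Surj W q` (Cremona/Sutherland `galrep`; in
print it follows from the record's image certificate `j(E) = J_G(t)` by Zywina 2015 Thm. 1.2/1.4/1.5 (ii))
`∧ (r_an = rank) ∧ BSD data ∧ the Iwasawa certificate`. Nothing asserted. [folklore] -/
def ClaimAt (q : ℕ) [Fact q.Prime] : Prop :=
  ¬ Surj W q ∧ r.ClaimRank W ∧ r.ClaimBSDData W ∧ r.ClaimLambdaAt W q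

/-- The record's CLAIM about `W` at its own prime `r.p`. [folklore] -/
def Claim [Fact r.p.Prime] : Prop := r.ClaimAt W r.p

variable {r W}

omit [W.IsElliptic] in
/-- From the Iwasawa certificate: SOME coefficient of the Néron-normalised `ϖ·L_p(f, α)` is a unit —
the `hcert` binder shape of `X9.mazurMainConjecture_of_ainvs_of_bsdp` / `X9MuInvariant` /
`MuZeroRoad` (newform at any level). [cite: GreenbergVatsal2000, p. 2–3, (2)] -/
theorem ClaimLambdaAt.exists_unit_coeff_neron {q : ℕ} [Fact q.Prime] (h : r.ClaimLambdaAt W q)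
    {N : ℕ} [NeZero N] (f : CuspForm (Gamma0 N) 2) (hf : IsNewformOf W f) (ϖ : ℚ)
    (hϖ : (ϖ : ℝ) * W.realPeriodRat = plusPeriod f) :
    ∃ n : ℕ, ‖PowerSeries.coeff n
      (PowerSeries.C (ϖ : ℚ_[q]) * padicLFunction f (unitRoot W q : ℚ_[q]))‖ = 1 :=
  ⟨r.lambdaAn, (h f hf ϖ hϖ).1⟩

/-- From the Iwasawa certificate and the PERIOD UNIT (`realPeriodRat_eq_unit_mul_plusPeriod`, `p ≥ 5`;
`…_three`, `p = 3`; PUBLISHED binders `h5`/`h3`): the coefficient of index `λ_an = r.lambdaAn` of the RAW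
`L_p(f, α)` is a unit and all lower ones are non-units (`ϖ` is a `p`-adic unit, `norm_periodRatio_eq_one_of_odd`).
Needs `p` odd, good reduction and `E[p]` irreducible (e.g. from the recheck). [cite: GreenbergVatsal2000, §3 Remark (3.4)] -/
theorem ClaimLambdaAt.norm_coeff_eq_one {q : ℕ} [Fact q.Prime] (h : r.ClaimLambdaAt W q)
    (h5 : realPeriodRat_eq_unit_mul_plusPeriod) (h3 : realPeriodRat_eq_unit_mul_plusPeriod_three)
    (hq2 : q ≠ 2) (hgood : W.HasGoodReductionAtPrime q) (hirr : W.HasIrreducibleModPGaloisRep q)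
    {N : ℕ} [NeZero N] (f : CuspForm (Gamma0 N) 2) (hf : IsNewformOf W f) :
    ‖PowerSeries.coeff r.lambdaAn (padicLFunction f (unitRoot W q : ℚ_[q]))‖ = 1 ∧
      ∀ m < r.lambdaAn, ‖PowerSeries.coeff m (padicLFunction f (unitRoot W q : ℚ_[q]))‖ < 1 := by
  have hqP : q.Prime := Fact.out
  -- a RATIONAL period ratio exists: `Ω_E = u·Ω⁺_f` with `‖u‖ = 1` (at `3` and at `q ≥ 5`), `ϖ = u⁻¹`
  have hu : ∃ u : ℚ, ‖(u : ℚ_[q])‖ = 1 ∧ W.realPeriodRat = u * plusPeriod f := by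
    by_cases h3q : q = 3
    · subst h3q
      exact h3 W hgood hirr f hf
    · have h4 : q ≠ 4 := by
        rintro rfl
        exact absurd hqP (by decide)
      have hq5 : 5 ≤ q := by have := hqP.two_le; omega
      exact h5 W q hq5 hgood hirr f hf
  obtain ⟨u, hu1, huΩ⟩ := hu
  have hu0 : u ≠ 0 := by
    rintro rfl
    simp at hu1
  have hϖ : ((u⁻¹ : ℚ) : ℝ) * W.realPeriodRat = plusPeriod f := by
    rw [huΩ]; push_cast; field_simp
  have hnorm : ‖((u⁻¹ : ℚ) : ℚ_[q])‖ = 1 :=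
    norm_periodRatio_eq_one_of_odd h5 h3 W q hq2 hgood hirr f hf u⁻¹ hϖ
  obtain ⟨h1, h2⟩ := h f hf u⁻¹ hϖ
  refine ⟨?_, fun m hm ↦ ?_⟩
  · rwa [PowerSeries.coeff_C_mul, norm_mul, hnorm, one_mul] at h1
  · have h2m := h2 m hm
    rwa [PowerSeries.coeff_C_mul, norm_mul, hnorm, one_mul] at h2m

/-- SOME coefficient of the raw `L_p(f, α)` is a unit — the per-pair instance of `AnalyticMuZeroOnClassX9` /
`AnalyticMuZeroOnClassX10b` (binders `hA` / `hμ_an` of the K6 leaf bridges, `hcert` of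
`X9.mazurMainConjecture_of_kato_of_mu_eq_zero_of_order_le`). [cite: GreenbergVatsal2000, §3 Remark (3.4)] -/
theorem ClaimLambdaAt.exists_unit_coeff {q : ℕ} [Fact q.Prime] (h : r.ClaimLambdaAt W q)
    (h5 : realPeriodRat_eq_unit_mul_plusPeriod) (h3 : realPeriodRat_eq_unit_mul_plusPeriod_three)
    (hq2 : q ≠ 2) (hgood : W.HasGoodReductionAtPrime q) (hirr : W.HasIrreducibleModPGaloisRep q)
    {N : ℕ} [NeZero N] (f : CuspForm (Gamma0 N) 2) (hf : IsNewformOf W f) :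
    ∃ n : ℕ, ‖PowerSeries.coeff n (padicLFunction f (unitRoot W q : ℚ_[q]))‖ = 1 :=
  ⟨r.lambdaAn, (h.norm_coeff_eq_one h5 h3 hq2 hgood hirr f hf).1⟩

/-- A `λ_an = 0` record gives the rank-`0` UNIT-CELL datum `‖L_p(f, α)(0)‖ = 1` (binder `hcert0` of
`X9.bsdp_of_fine_of_norm_constantCoeff_eq_one`). [cite: GreenbergVatsal2000, §3 Remark (3.4)] -/
theorem ClaimLambdaAt.norm_coeff_zero_eq_one {q : ℕ} [Fact q.Prime] (h : r.ClaimLambdaAt W q)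
    (hl : r.lambdaAn = 0) (h5 : realPeriodRat_eq_unit_mul_plusPeriod)
    (h3 : realPeriodRat_eq_unit_mul_plusPeriod_three) (hq2 : q ≠ 2) (hgood : W.HasGoodReductionAtPrime q)
    (hirr : W.HasIrreducibleModPGaloisRep q) {N : ℕ} [NeZero N] (f : CuspForm (Gamma0 N) 2)
    (hf : IsNewformOf W f) : ‖PowerSeries.coeff 0 (padicLFunction f (unitRoot W q : ℚ_[q]))‖ = 1 :=
  hl ▸ (h.norm_coeff_eq_one h5 h3 hq2 hgood hirr f hf).1

/-- A `λ_an = 1` record gives the rank-`1` datum `‖[T¹]L_p(f, α)‖ = 1` (binder `hcert1` of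
`X9.bsdp_rankOne_of_fine_of_norm_coeff_one_eq_one`) — and `‖L_p(f, α)(0)‖ < 1`. [cite: GreenbergVatsal2000, §3 Remark (3.4)] -/
theorem ClaimLambdaAt.norm_coeff_one_eq_one {q : ℕ} [Fact q.Prime] (h : r.ClaimLambdaAt W q)
    (hl : r.lambdaAn = 1) (h5 : realPeriodRat_eq_unit_mul_plusPeriod)
    (h3 : realPeriodRat_eq_unit_mul_plusPeriod_three) (hq2 : q ≠ 2) (hgood : W.HasGoodReductionAtPrime q)
    (hirr : W.HasIrreducibleModPGaloisRep q) {N : ℕ} [NeZero N] (f : CuspForm (Gamma0 N) 2)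
    (hf : IsNewformOf W f) :
    ‖PowerSeries.coeff 1 (padicLFunction f (unitRoot W q : ℚ_[q]))‖ = 1 ∧
      ‖PowerSeries.coeff 0 (padicLFunction f (unitRoot W q : ℚ_[q]))‖ < 1 := by
  obtain ⟨h1, h2⟩ := h.norm_coeff_eq_one h5 h3 hq2 hgood hirr f hf
  rw [hl] at h1 h2
  exact ⟨h1, h2 0 zero_lt_one⟩

end Claims

end Record

/-- CLAIMS for a display list: every listed record's claim holds for its own curve. [folklore] -/
def Claims (rs : List Record) : Prop :=
  ∀ r ∈ rs, ∀ [Fact r.p.Prime] [r.curve.IsElliptic] [r.curve.IsGloballyMinimal], r.Claim r.curve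

/-- **Display-list form of the X9 leaf predicate**: for a `Certified` list, every listed record with
`p ≥ 5` whose claims `¬Surj`, `r_an = rank` hold puts its (globally minimal) curve in `ClassX9` — the
census membership, kernel-checked up to the two claims. [folklore] -/
theorem classX9_of_certified {rs : List Record} (hC : Certified rs) (r : Record) (hr : r ∈ rs)
    [Fact r.p.Prime] [r.curve.IsElliptic] [r.curve.IsGloballyMinimal] (hp5 : 5 ≤ r.p)
    (hns : ¬ Surj r.curve r.p) (hrank : r.curve.analyticRank = r.rank) : ClassX9 r.curve r.p :=
  r.classX9_of_check r.integralModelInt_curve (hC.check_of_mem hr) rfl hp5 hns hrank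

/-- The same with the two claims read from `Claims`. [folklore] -/
theorem classX9_of_certified_of_claims {rs : List Record} (hC : Certified rs) (hcl : Claims rs) (r : Record)
    (hr : r ∈ rs) [Fact r.p.Prime] [r.curve.IsElliptic] [r.curve.IsGloballyMinimal] (hp5 : 5 ≤ r.p) :
    ClassX9 r.curve r.p :=
  have h := hcl r hr
  r.classX9_of_check r.integralModelInt_curve (hC.check_of_mem hr) rfl hp5 h.1 h.2.1

/-- **Display-list form of the X10b leaf predicate** (`p = 3`): for a `Certified` list whose `Claims` hold,
every listed record with `p = 3` has its curve in `ClassX10 ∧ ¬Surj W 3` — (ram)/semistability, good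
ordinary, irreducible kernel-checked; `¬Surj` and the analytic rank from the claim. [folklore] -/
theorem classX10b_of_certified_of_claims {rs : List Record} (hC : Certified rs) (hcl : Claims rs)
    (r : Record) (hr : r ∈ rs) [Fact r.p.Prime] [r.curve.IsElliptic] [r.curve.IsGloballyMinimal]
    (hp3 : r.p = 3) : ClassX10 r.curve 3 ∧ ¬ Surj r.curve 3 := by
  have h := hcl r hr
  -- move the literal `3` to `r.p` (`Fact` instances are propositions)
  have key : ∀ (q : ℕ) [Fact q.Prime], q = r.p → Surj r.curve q → Surj r.curve r.p := by
    rintro q _ rfl hs; exact hs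
  exact ⟨r.classX10_of_check r.integralModelInt_curve (hC.check_of_mem hr) hp3 hp3.symm h.2.1,
    fun hs ↦ h.1 (key 3 hp3.symm hs)⟩

end Summit.BirchSwinnertonDyer.Rank1Residual.X9.PrintCert

end
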